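import Literature.IUT.LogVolume.TensorPacketStepVWith
import Literature.IUT.LogVolume.GenuineLogThetaPerImage
import HarnessLib

/-!
# [IUTchIV] Thm. 1.10 Step (v) PER SUMMAND for ONE (Ind1)-slot datum — the per-image form, in the real packet

Mochizuki, *Inter-universal Teichmüller theory IV* (RIMS ms Apr. 2020 = PRIMS **57** (2021)), proof of Thm. 1.10,
Step (v), p. 27–28: «the indeterminacies (Ind1) and (Ind2) are taken into account by the arbitrary nature of the
automorphism “φ” [cf. Proposition 1.2] … an upper bound on the component of the log-volume of the holomorphic
hull … may be obtained by computing an upper bound for the log-volume of … “p^{⌊λ−d_I−a_I⌋−b_I}·(R_I)^∼”. Such an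
upper bound “(−λ + d_I + 1)·log(p) + Σ_{i∈I*} {3 + log(e_i)}” is given in the second displayed inequality of
Proposition 1.4, (iii)». Companion of `TensorPacketStepVWith.lean` (abc-iut-c312-d1): there the hull of the WHOLE
local (Ind2)·(Ind1)-orbit is bounded, and the (Ind1)-permutations that move a collection cost the slot term
`{θ(v_j) − min_a θ(v_a)}` (plan/c312/STEPV-IND1-NOTE.md, the `λ_min` form). HERE the (Ind1)-slot datum is FIXED
(reading (P) of `GenuineLogThetaPerImage.lean`: the hull of `⋃_{g ∈ G₂(v⃗)} g·O_𝕃(−P_Θ)_{v⃗}`), every `g` is a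
lattice automorphism of the FIXED `⊗_{i∈I} K_{v̲_i}` — Mochizuki's «arbitrary φ» — and the text's bound holds
VERBATIM, with NO slot term and NO slot-constancy hypothesis:
* `realPrimePacketWith_slotStepV` — for `|I| = j+1 ≥ 2`, theta value `t ∈ K_{v̲_j}^×` at the last slot, the hull of
  `⋃_g g·(ι_j(t)·(R_I)^∼)` is admissible and `log μ̄(hull) − log μ̄(ι_j(t)·(R_I)^∼) ≤ {d_I + 1}·log(p) +
  Σ_{i∈I*}{3 + log(e_i)}` (abc-iut-S2's `packetLogμ_packetHull_le_of_subset_autImages` with `i† := j`, over abc-iut-S8's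
  PROVED Prop. 1.4 (iii) second inequality; [IUTchIV] Prop. 1.2 (ii) enters as the hypothesis `Prop12ii`, discharged
  by `prop12ii_holds` downstream);
* `PrimePacket.slotComponentBound_of_eq_with` — the same for any prime packet EQUAL to the real one, in the
  `slotImagesHull`/`pilotRegion` vocabulary of `GenuineLogThetaPerImage.lean` (the `p`-part of a model assembled by
  `ofPrimesLine`; the shape abc-iut-c312-d1's `componentBound_of_eq_with` has for the full orbit).
THEOREMS ONLY (abc-iut cell, campaign-S seat abc-iut-S7, plan ruling 2026-08-26T02:51:47Z (2)(c)); no side taken on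
[IUTchIII] Cor. 3.12; typed ≠ endorsed. [cite: Mochizuki2012, IUTchIV Thm 1.10 proof Step (v) p.27–28]
[cite: DupuyHilado2025, §3.9, §4.9, §4.12]
-/

noncomputable section

open Set MeasureTheory NumberField IsDedekindDomain
open scoped Pointwise TensorProduct

namespace Literature.IUT.LogVolume

section RealPacketWith

variable {F : Type} [Field F] [NumberField F]
variable (p : ℕ) [Fact p.Prime] (𝔽 : LocalFields F p)
variable (c : (j : ℕ) → (Fin (j + 1) → placesOver F p) → ℚ_[p]) (hc0 : ∀ j e, c j e ≠ 0)
  (hcσ : ∀ (j : ℕ) (σ : Equiv.Perm (Fin (j + 1))) (e : Fin (j + 1) → placesOver F p), c j (e ∘ σ) = c j e)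

/-- **Step (v) per summand for ONE slot datum, in the real packet.** Degree `j ≥ 1`, summand `v⃗ = (v_0,…,v_j)`,
theta value `t ∈ K_{v̲_j}^×` at the LAST slot, a region `B` with `B = t·O_{v⃗}` (the SHARP (Ind3) reading, as two
inclusions), [IUTchIV] Prop. 1.2 (ii) for the packet (`Prop12ii`), `I* ⊇` the slots where `e_i > p − 2`. Then the
hull of the (Ind2)-orbit `⋃_g g·B` — NO factor permutation — is admissible and
`log μ̄(hull(⋃_g g·B)) − log μ̄(t·O_{v⃗}) ≤ {d_I + 1}·log(p) + Σ_{i∈I*}{3 + log(e_i)}`: the text's bound with `i† = j`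
and no slot term. [cite: Mochizuki2012, IUTchIV Thm 1.10 proof Step (v) p.27–28] -/
theorem realPrimePacketWith_slotStepV {j : ℕ} (hj : 1 ≤ j) (e : Fin (j + 1) → placesOver F p)
    (h12 : Prop12ii p (fun i => 𝔽.k (e i)))
    (t : (𝔽.k (e (Fin.last j)))ˣ)
    (B : Set ((realPrimePacketWith p 𝔽 c hc0 hcσ).X j e))
    (hB : B ⊆ (realPrimePacketWith p 𝔽 c hc0 hcσ).peel t '' (realPrimePacketWith p 𝔽 c hc0 hcσ).O j e)
    (hB1 : (realPrimePacketWith p 𝔽 c hc0 hcσ).peel t '' (realPrimePacketWith p 𝔽 c hc0 hcσ).O j e ⊆ B)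
    (Istar : Finset (Fin (j + 1)))
    (htame : ∀ i, i ∉ Istar → absRamificationIdx p (𝔽.k (e i)) ≤ p - 2) :
    PacketAdm p (fun i => 𝔽.k (e i)) (packetHull p (fun i => 𝔽.k (e i))
        (⋃ g : (realPrimePacketWith p 𝔽 c hc0 hcσ).G₂ j e, g • B)) ∧
      packetLogμ p (fun i => 𝔽.k (e i)) (packetHull p (fun i => 𝔽.k (e i))
            (⋃ g : (realPrimePacketWith p 𝔽 c hc0 hcσ).G₂ j e, g • B))
          - packetLogμ p (fun i => 𝔽.k (e i))
              ((realPrimePacketWith p 𝔽 c hc0 hcσ).peel t '' (realPrimePacketWith p 𝔽 c hc0 hcσ).O j e)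
        ≤ (dSum p (fun i => 𝔽.k (e i)) + 1) * Real.log p
            + ∑ i ∈ Istar, (3 + Real.log (absRamificationIdx p (𝔽.k (e i)))) := by
  set U : Set (PacketAlgebra p (fun i => 𝔽.k (e i))) :=
    ⋃ g : (realPrimePacketWith p 𝔽 c hc0 hcσ).G₂ j e, g • B with hU
  have hI : 2 ≤ Fintype.card (Fin (j + 1)) := by rw [Fintype.card_fin]; omega
  haveI : Nonempty (Fin (j + 1)) := ⟨0⟩
  have ht0 : (t : (fun i => 𝔽.k (e i)) (Fin.last j)) ≠ 0 := t.ne_zero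
  obtain ⟨m, hm⟩ := exists_norm_eq_rpow p ((fun i => 𝔽.k (e i)) (Fin.last j)) ht0
  obtain ⟨h, hh⟩ := exists_realizesNegB p (fun i => 𝔽.k (e i))
  -- the bare region is the twist of `(R_I)^∼` at the last slot
  have hbare : (realPrimePacketWith p 𝔽 c hc0 hcσ).peel t '' (realPrimePacketWith p 𝔽 c hc0 hcσ).O j e =
      iota p (fun i => 𝔽.k (e i)) (Fin.last j) (t : (fun i => 𝔽.k (e i)) (Fin.last j)) •
        (normalizedPacket p (fun i => 𝔽.k (e i)) : Set (PacketAlgebra p (fun i => 𝔽.k (e i)))) := by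
    rw [realPrimePacketWith_peel_image', realPrimePacketWith_O']
  -- it lies in the (Ind2)-orbit (identity), and the orbit lies in the union of its possible images
  have hUl : iota p (fun i => 𝔽.k (e i)) (Fin.last j) (t : (fun i => 𝔽.k (e i)) (Fin.last j)) •
      (normalizedPacket p (fun i => 𝔽.k (e i)) : Set (PacketAlgebra p (fun i => 𝔽.k (e i)))) ⊆ U := by
    rw [← hbare]
    refine hB1.trans fun x hx => ?_
    refine Set.mem_iUnion.mpr ⟨1, ?_⟩
    rw [one_smul]
    exact hx
  have hUu : U ⊆ autImages p (fun i => 𝔽.k (e i))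
      (iota p (fun i => 𝔽.k (e i)) (Fin.last j) (t : (fun i => 𝔽.k (e i)) (Fin.last j)) •
        (normalizedPacket p (fun i => 𝔽.k (e i)) : Set (PacketAlgebra p (fun i => 𝔽.k (e i))))) := by
    refine Set.iUnion_subset fun g => ?_
    have h1 : B ⊆ iota p (fun i => 𝔽.k (e i)) (Fin.last j) (t : (fun i => 𝔽.k (e i)) (Fin.last j)) •
        (normalizedPacket p (fun i => 𝔽.k (e i)) : Set (PacketAlgebra p (fun i => 𝔽.k (e i)))) := by
      rw [← hbare]; exact hB
    exact (Set.smul_set_mono h1).trans (indTwo_smul_subset_autImages p _ g _)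
  -- the text's container bound with `i† := j`
  have hres := packetLogμ_packetHull_le_of_subset_autImages p (fun i => 𝔽.k (e i)) h12 hI Istar htame
    (Fin.last j) m (t : (fun i => 𝔽.k (e i)) (Fin.last j)) hm h hh hUl hUu
  refine ⟨hres.1, ?_⟩
  have hq : packetLogμ p (fun i => 𝔽.k (e i))
      ((realPrimePacketWith p 𝔽 c hc0 hcσ).peel t '' (realPrimePacketWith p 𝔽 c hc0 hcσ).O j e) =
      Real.log ‖(t : 𝔽.k (e (Fin.last j)))‖ := by
    have := packetLogμ_iota_smul_normalizedPacket p (fun i => 𝔽.k (e i)) (Fin.last j) ht0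
    rw [← hbare] at this
    exact this
  rw [hq]
  have hl0 := (slot_ne_zero_and_log_norm p (fun i => 𝔽.k (e i)) hm).2
  have h2 := hres.2
  rw [hl0]
  linarith

end RealPacketWith

/-! ## In the `slotImagesHull`/`pilotRegion` vocabulary, for any packet equal to the real one -/

namespace PrimePacket

variable {F : Type} [Field F] [NumberField F]
variable {p : ℕ} [Fact p.Prime] (𝔽 : LocalFields F p)
variable (c : (j : ℕ) → (Fin (j + 1) → placesOver F p) → ℚ_[p]) (hc0 : ∀ j e, c j e ≠ 0)
  (hcσ : ∀ (j : ℕ) (σ : Equiv.Perm (Fin (j + 1))) (e : Fin (j + 1) → placesOver F p), c j (e ∘ σ) = c j e)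

omit [Fact p.Prime] in
/-- The bare region in a degree `j = i+1 ≤ ℓ⋇` is the twist through the last slot (`pilotRegion` unfolded).
[cite: DupuyHilado2025, §3.9] -/
theorem pilotRegion_succ_eq (Q : PrimePacket F p) {lstar : ℕ} (t : Fin lstar → (v : placesOver F p) → Q.Λ v)
    (i : Fin lstar) (e : Fin ((i : ℕ) + 1 + 1) → placesOver F p) :
    Q.pilotRegion t ((i : ℕ) + 1) e = Q.peel (t i (e (Fin.last _))) '' Q.O _ e := by
  have h : 0 < (i : ℕ) + 1 ∧ (i : ℕ) + 1 - 1 < lstar := ⟨Nat.succ_pos _, by have := i.2; omega⟩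
  simp only [pilotRegion, dif_pos h]
  rfl

/-- **The per-image Step (v) bound for ANY prime packet EQUAL to the real one** (the `p`-part of a model assembled
by `IndPacketModel.ofPrimesLine`), in the vocabulary of `GenuineLogThetaPerImage.lean`: for the theta idele `t`, a
degree `j = i+1`, a collection `v⃗`, a region `B` with `B_{v⃗} = O_𝕃(−div t)_{v⃗}` (sharp, as two inclusions) and the
tameness set `I*`, the slot-image hull is admissible and `log μ̄(hull(⋃_g g·B_{v⃗})) ≤ log μ̄(O_𝕃(−div t)_{v⃗}) +
{d_I + 1}·log(p) + Σ_{a∈I*}{3 + log(e_a)}` — the TEXT's per-collection discrepancy, NO slot term.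
[cite: Mochizuki2012, IUTchIV Thm 1.10 proof Step (v) p.27–28] -/
theorem slotComponentBound_of_eq_with (Q : PrimePacket F p) (hQ : Q = realPrimePacketWith p 𝔽 c hc0 hcσ)
    {lstar : ℕ} (t : Fin lstar → (v : placesOver F p) → Q.Λ v) (i : Fin lstar)
    (e : Fin ((i : ℕ) + 1 + 1) → placesOver F p) (h12 : Prop12ii p (fun a => 𝔽.k (e a)))
    (B : Q.Region) (hB : Q.pilotRegion t ((i : ℕ) + 1) e ⊆ B _ e)
    (hsharp : B _ e ⊆ Q.pilotRegion t ((i : ℕ) + 1) e)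
    (Istar : Finset (Fin ((i : ℕ) + 1 + 1)))
    (htame : ∀ a, a ∉ Istar → absRamificationIdx p (𝔽.k (e a)) ≤ p - 2) :
    Q.adm (Q.slotImagesHull B _ e) ∧
      Q.logμ (Q.slotImagesHull B _ e) ≤ Q.logμ (Q.pilotRegion t ((i : ℕ) + 1) e)
        + ((dSum p (fun a => 𝔽.k (e a)) + 1) * Real.log p
            + ∑ a ∈ Istar, (3 + Real.log (absRamificationIdx p (𝔽.k (e a))))) := by
  subst hQ
  have hj : 1 ≤ (i : ℕ) + 1 := by omega
  rw [pilotRegion_succ_eq] at hB hsharp ⊢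
  have h := realPrimePacketWith_slotStepV p 𝔽 c hc0 hcσ hj e h12 (t i (e (Fin.last _))) (B _ e) hsharp hB
    Istar htame
  refine ⟨h.1, ?_⟩
  have h2 := h.2
  show packetLogμ p (fun a => 𝔽.k (e a)) (packetHull p (fun a => 𝔽.k (e a))
      (⋃ g : (realPrimePacketWith p 𝔽 c hc0 hcσ).G₂ _ e, g • B _ e)) ≤
    packetLogμ p (fun a => 𝔽.k (e a))
        ((realPrimePacketWith p 𝔽 c hc0 hcσ).peel (t i (e (Fin.last _))) ''
          (realPrimePacketWith p 𝔽 c hc0 hcσ).O _ e) + _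
  linarith

end PrimePacket

end Literature.IUT.LogVolume

end
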